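import Literature.Topology.FourManifolds.CodimTwoLinkingHomomorphismConnected
import Literature.Topology.FourManifolds.CodimTwoCircleMap
import Literature.Topology.FourManifolds.PontryaginThomCollapseTwist
import Literature.Topology.FourManifolds.DehnSurgeryTwistProofs
import HarnessLib

/-!
# Re-framing a codimension-two framed submanifold so that the pushoffs do not link the core
# (Kirby 1989, VIII Thm. 3 for a connected core: the choice of the trivialisation)

Topic `Literature/Topology/FourManifolds`; fact seat
`provefact-Literature.Topology.FourManifolds.isOrientedBordant_of_isEmpty_of_signature_eq_zero`
(Kirby, *The Topology of 4-Manifolds* (1989), Cor. IX.2 via VIII Thm 1(A) and VIII Thm 3).  The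
datum of the Seifert hypersurface construction (`CodimTwoCircleMap.lean`,
`nonempty_seifertHypersurfaceDatum_of_linkingHom`) asks for a linking homomorphism
`φ : π₁(Sⁿ⁺² ∖ M, p₀) → ℤ`, `φ [μ] = 1`, which **vanishes on the pushoffs** `t ↦ tube (δ t, e₀)`
of the loops `δ` of the core.  For a simply connected core this is automatic; for a merely
**connected** core (Kirby's `M₃ ⊂ ℝ⁶` in the proof of VIII Thm 1(A) is not simply connected) the
framing has to be changed first — the classical remark that the trivialisation of the normal
bundle of `N ⊂ Q` may be altered by any map `N → SO(2) = S¹` so that the parallel copy of `N`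
is annihilated by the class `α ∈ H¹(Q ∖ N) = Hom(π₁, ℤ)` dual to the meridian (Kirby 1989, proof
of VIII Thm. 3, p. 45; for knots: the `0`-framing / preferred longitude, Rolfsen, *Knots and
Links*, §5.D).  Everything here is **proved**; no named fact is introduced.

* `CodimTwo.rotEquiv u` — rotation of `ℝ²` by the angle of `u ∈ S¹` (complex multiplication, the
  tree's `fibreRot 1 u`) as a continuous linear automorphism.
* `FramedTubularEmbedding.rotTwist E u` — the framed tubular embedding `E` **twisted by the
  rotations of angle `u x`**, `u : M → S¹` smooth: tube `(x, w) ↦ E.tube (x, u(x)·w)`; an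
  instance of the tree's `FramedTubularEmbedding.twist` (`PontryaginThomCollapseTwist.lean`), with
  the same core (`rotTwist_emb`) and the same complement (`rotTwistIncl`).
* `FramedTubularEmbedding.twistedPushoff_homotopic` — **the pushoff twisted by `u` is the untwisted
  pushoff followed by `μᵏ`**, `k` the winding number of `u` along the loop: in `π₁(Sⁿ⁺² ∖ M, p₀)`,
  `[t ↦ tube (δ t, u (δ t))] = [t ↦ tube (δ t, e₀)] · [μᵏ]` (through the map
  `M × ℝ ∋ (x, b) ↦ tube (x, e^{2πib})` and the simple connectivity of `ℝ`).
* `exists_circleMap_winding_eq` — a smooth `u : M → S¹`, `u x₀ = e₀`, with prescribed winding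
  homomorphism `π₁(M, x₀) → ℤ` (Hatcher Prop. 1B.9 in the tree's smooth form
  `exists_contMDiff_circleMap_realising`, normalised at the base point).
* `FramedTubularEmbedding.exists_rotTwist_linkingHom_pushoff` — **for a connected compact core
  (`n ≥ 1`) there is a smooth `u : M → S¹` such that the twisted framing admits a linking
  homomorphism `φ'` with `φ' [μ] = 1` killing all its pushoffs**: take the linking homomorphism
  `φ` of `CodimTwoLinkingHomomorphismConnected.lean` (`φ [μᵏ] = k`), realise
  `δ ↦ -φ [pushoff δ]` by `u`; the pushoffs of the twisted framing are the `u`-twisted pushoffs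
  of `E`, of class `[pushoff δ]·[μ]^{-φ[pushoff δ]}`, on which `φ` vanishes; and `φ' = φ`
  transported along the identity of the complements.
* `FramedTubularEmbedding.exists_rotTwist_nonempty_seifertHypersurfaceDatum` — hence **Seifert
  hypersurface data exist for a suitably twisted framing of any connected compact core**
  (`CodimTwoCircleMap.lean`, `nonempty_seifertHypersurfaceDatum_of_linkingHom`).

## References

* R. C. Kirby, *The Topology of 4-Manifolds*, LNM 1374 (1989), Ch. VIII, Thm. 3 and its proof
  (pp. 44–45), proof of Thm. 1 (p. 46). [Kirby1989]
* A. Hatcher, *Algebraic Topology* (2002), Prop. 1B.9, Prop. 1.12. [HatcherAT2002]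
* D. Rolfsen, *Knots and Links* (1976), §5.D (longitudes and framings). [Rolfsen1976]
-/

noncomputable section

open Set Function Filter
open scoped Manifold ContDiff Topology Real

namespace Literature.Topology.FourManifolds

/-- Local notation: `𝔼 n` is the model Euclidean space `EuclideanSpace ℝ (Fin n)`. -/
local notation "𝔼 " n:arg => EuclideanSpace ℝ (Fin n)

/-- Local notation: `𝕊 n` is the unit sphere in `EuclideanSpace ℝ (Fin (n + 1))`. -/
local notation "𝕊 " n:arg => (Metric.sphere (0 : EuclideanSpace ℝ (Fin (n + 1))) 1)

/-- Local notation for the homotopy class of a path (Mathlib's `Path.Homotopic.Quotient.mk`). -/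
local notation "⟦" p "⟧ₚ" => Path.Homotopic.Quotient.mk p

-- `Fact (finrank ℝ ℝᵐ⁺¹ = m + 1)`, under which Mathlib charts the round spheres on `ℝᵐ`.
attribute [local instance] fact_finrank_euclideanSpace_succ

/-! ### Rotations of the plane as continuous linear automorphisms -/

namespace CodimTwo

/-- **Rotation by the angle of `u`** (complex multiplication by `u = u₀ + iu₁`), the tree's
`fibreRot 1 u`, as a linear map of `ℝ²`. [folklore] -/
def rotLin (u : 𝔼 2) : 𝔼 2 →ₗ[ℝ] 𝔼 2 where
  toFun := fibreRot 1 u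
  map_add' := fibreRot_add 1 u
  map_smul' r w := by rw [fibreRot_smul, RingHom.id_apply]

/-- `rotLin u w = fibreRot 1 u w`. [folklore] -/
@[simp] theorem rotLin_apply (u w : 𝔼 2) : rotLin u w = fibreRot 1 u w := rfl

/-- Rotation by the angle of `u`, as a continuous linear map. [folklore] -/
def rotCLM (u : 𝔼 2) : 𝔼 2 →L[ℝ] 𝔼 2 := LinearMap.toContinuousLinearMap (rotLin u)

/-- `rotCLM u w = fibreRot 1 u w`. [folklore] -/
@[simp] theorem rotCLM_apply (u w : 𝔼 2) : rotCLM u w = fibreRot 1 u w := rfl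

/-- The rotation depends smoothly on `u` (it is linear in `u`). [folklore] -/
theorem contDiff_rotCLM : ContDiff ℝ ∞ rotCLM :=
  contDiff_clm_apply_iff.2 fun w =>
    show ContDiff ℝ ∞ (fun x : 𝔼 2 => fibreRot 1 x w) from
      (contDiff_fibreRot 1).comp₂ contDiff_id contDiff_const

/-- **The rotation by the angle of a unit vector `u` as a continuous linear automorphism of
`ℝ²`**, with inverse the rotation by the opposite angle (`fibreRot (-1) u`). [folklore] -/
def rotEquiv (u : 𝕊 1) : 𝔼 2 ≃L[ℝ] 𝔼 2 :=
  ({ rotLin (u : 𝔼 2) with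
      invFun := fibreRot (-1) (u : 𝔼 2)
      left_inv := fun w => fibreRot_neg_fibreRot_of_sq (by norm_num : (1 : ℝ) ^ 2 = 1) u w
      right_inv := fun w => fibreRot_fibreRot_neg_of_sq (by norm_num : (1 : ℝ) ^ 2 = 1) u w } :
    𝔼 2 ≃ₗ[ℝ] 𝔼 2).toContinuousLinearEquiv

/-- `rotEquiv u w = fibreRot 1 u w`. [folklore] -/
@[simp] theorem rotEquiv_apply (u : 𝕊 1) (w : 𝔼 2) :
    rotEquiv u w = fibreRot 1 (u : 𝔼 2) w := rfl

/-- The underlying continuous linear map of `rotEquiv u` is `rotCLM u`. [folklore] -/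
theorem rotEquiv_coe (u : 𝕊 1) : (rotEquiv u : 𝔼 2 →L[ℝ] 𝔼 2) = rotCLM (u : 𝔼 2) :=
  ContinuousLinearMap.ext fun _ => rfl

/-- **Angle addition**: rotating `e^{ib}` by the angle of `e^{ia}` gives `e^{i(a+b)}`. [folklore] -/
theorem fibreRot_one_circlePoint (a b : ℝ) :
    fibreRot 1 ((circlePoint a : 𝕊 1) : 𝔼 2) ((circlePoint b : 𝕊 1) : 𝔼 2) =
      ((circlePoint (a + b) : 𝕊 1) : 𝔼 2) := by
  ext i
  fin_cases i
  · simp [Real.cos_add]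
  · simp [Real.sin_add]

/-- Rotating back: `fibreRot (-1) e^{ia} e^{ib} = e^{i(b-a)}`. [folklore] -/
theorem fibreRot_neg_one_circlePoint (a b : ℝ) :
    fibreRot (-1) ((circlePoint a : 𝕊 1) : 𝔼 2) ((circlePoint b : 𝕊 1) : 𝔼 2) =
      ((circlePoint (b - a) : 𝕊 1) : 𝔼 2) := by
  ext i
  fin_cases i
  · simp [Real.cos_sub]
    ring
  · simp [Real.sin_sub]
    ring

/-- Rotating the base vector `e₀ = (1, 0)` by the angle of `u` gives `u`. [folklore] -/
theorem fibreRot_one_base (u : 𝔼 2) : fibreRot 1 u ((circlePoint 0 : 𝕊 1) : 𝔼 2) = u := by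
  ext i
  fin_cases i <;> simp

/-- Rotations by unit vectors preserve the norm (`s = ±1`). [folklore] -/
theorem norm_fibreRot_of_sq {s : ℝ} (hs : s ^ 2 = 1) (u : 𝕊 1) (w : 𝔼 2) :
    ‖fibreRot s (u : 𝔼 2) w‖ = ‖w‖ := by
  have hu : (u : 𝔼 2) 0 ^ 2 + (u : 𝔼 2) 1 ^ 2 = 1 := by
    have h := norm_eq_of_mem_sphere u
    rw [EuclideanSpace.norm_eq, Fin.sum_univ_two, Real.norm_eq_abs, Real.norm_eq_abs, sq_abs,
      sq_abs, Real.sqrt_eq_one] at h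
    exact h
  have hsq : ‖fibreRot s (u : 𝔼 2) w‖ ^ 2 = ‖w‖ ^ 2 := by
    rw [EuclideanSpace.norm_eq, EuclideanSpace.norm_eq,
      Real.sq_sqrt (Finset.sum_nonneg fun _ _ => sq_nonneg _),
      Real.sq_sqrt (Finset.sum_nonneg fun _ _ => sq_nonneg _)]
    simp only [Fin.sum_univ_two, Real.norm_eq_abs, sq_abs, fibreRot_apply_zero, fibreRot_apply_one]
    linear_combination (w 0 ^ 2 + w 1 ^ 2) * hu + (u : 𝔼 2) 1 ^ 2 * (w 0 ^ 2 + w 1 ^ 2) * hs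
  nlinarith [norm_nonneg (fibreRot s (u : 𝔼 2) w), norm_nonneg w]

/-- The segment `t ↦ kt` in `ℝ` from `0` to `k`. [folklore] -/
def segK (k : ℤ) : Path (0 : ℝ) (k : ℝ) where
  toFun t := (k : ℝ) * (t : ℝ)
  continuous_toFun := by fun_prop
  source' := by simp
  target' := by simp

/-- Values of `segK`. [folklore] -/
@[simp] theorem segK_apply (k : ℤ) (t : unitInterval) : segK k t = (k : ℝ) * (t : ℝ) := rfl

end CodimTwo

open CodimTwo

/-! ### Casts, maps and compositions of paths -/

section Paths

variable {X Y : Type*} [TopologicalSpace X] [TopologicalSpace Y]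

/-- Casting the composite of two mapped paths: `(f ∘ p)·(f ∘ q) = f ∘ (p·q)` with the end points
renamed. [folklore] -/
theorem cast_map_trans {a b c : X} (p : Path a b) (q : Path b c) {f : X → Y} (hf : Continuous f)
    {a' b' c' : Y} (ha : a' = f a) (hb : b' = f b) (hc : c' = f c) :
    ((p.map hf).cast ha hb).trans ((q.map hf).cast hb hc) = ((p.trans q).map hf).cast ha hc := by
  subst ha hb hc
  exact (Path.map_trans p q hf).symm

/-- In the fundamental group the class of a composite `p·q` is the product `[q] * [p]`
(Mathlib's multiplication of `π₁` is composition in the fundamental groupoid). [folklore] -/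
theorem fromPath_mk_trans {x : X} (p q : Path x x) :
    FundamentalGroup.fromPath ⟦p.trans q⟧ₚ =
      FundamentalGroup.fromPath ⟦q⟧ₚ * FundamentalGroup.fromPath ⟦p⟧ₚ := rfl

end Paths

/-! ### Normalised circle-valued maps with prescribed winding -/

section Winding

variable {n : ℕ} {M : Type*} [TopologicalSpace M] [ChartedSpace (𝔼 n) M]

/-- **A smooth circle-valued map with prescribed windings, normalised at `x₀`.**  For a
homomorphism `ρ : π₁(M, x₀) → ℤ` on a connected σ-compact Hausdorff `C^∞` manifold `M` there is a
`C^∞` map `u : M → S¹` with `u x₀ = e₀` whose winding along every loop `δ` at `x₀` is `ρ [δ]`: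
an angle function `B`, `u (δ t) = e^{2πiB(t)}`, with `B 0 = 0` and `B 1 = ρ [δ]` (Hatcher,
Prop. 1B.9, in the tree's smooth form `exists_contMDiff_circleMap_realising`, rotated back by the
constant angle of its value at `x₀` and with the angle function shifted by an integer).
[cite: HatcherAT2002, Prop. 1B.9] -/
theorem exists_circleMap_winding_eq [IsManifold (𝓡 n) ∞ M] [T2Space M] [SigmaCompactSpace M]
    [ConnectedSpace M] (x₀ : M) (ρ : FundamentalGroup M x₀ →* Multiplicative ℤ) :
    ∃ (u : M → 𝕊 1) (_ : ContMDiff (𝓡 n) (𝓡 1) ∞ u), u x₀ = circlePoint 0 ∧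
      ∀ δ : Path x₀ x₀, ∃ B : unitInterval → ℝ, Continuous B ∧ B 0 = 0 ∧
        B 1 = Multiplicative.toAdd (ρ (FundamentalGroup.fromPath ⟦δ⟧ₚ)) ∧
        ∀ t, ((u (δ t) : 𝕊 1) : 𝔼 2) = ((circlePoint (2 * π * B t) : 𝕊 1) : 𝔼 2) := by
  haveI : Fact (Module.finrank ℝ (𝔼 2) = 1 + 1) := ⟨by simp⟩
  haveI : LocallyPathConnectedSpace M := ChartedSpace.locallyPathConnectedSpace (𝔼 n) M
  haveI : PathConnectedSpace M := pathConnectedSpace_iff_connectedSpace.2 inferInstance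
  obtain ⟨θ, hθ, hang⟩ := exists_contMDiff_circleMap_realising (E := 𝔼 n) x₀ ρ
  obtain ⟨a, ha⟩ := circlePoint_surjective (θ x₀)
  -- rotate back by the angle `a` of `θ x₀`
  have hmem : ∀ x, fibreRot (-1) ((circlePoint a : 𝕊 1) : 𝔼 2) (θ x : 𝔼 2) ∈
      Metric.sphere (0 : 𝔼 2) 1 := fun x => by
    rw [mem_sphere_zero_iff_norm, norm_fibreRot_of_sq (by norm_num) (circlePoint a),
      norm_eq_of_mem_sphere]
  have hsm : ContMDiff (𝓡 n) 𝓘(ℝ, 𝔼 2) ∞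
      fun x => fibreRot (-1) ((circlePoint a : 𝕊 1) : 𝔼 2) (θ x : 𝔼 2) :=
    (contDiff_fibreRot (-1)).comp_contMDiff
      (contMDiff_const.prodMk_space (contMDiff_coe_sphere.comp hθ))
  refine ⟨Set.codRestrict _ _ hmem, hsm.codRestrict_sphere hmem, ?_, fun δ => ?_⟩
  · apply Subtype.ext
    show fibreRot (-1) ((circlePoint a : 𝕊 1) : 𝔼 2) (θ x₀ : 𝔼 2) = ((circlePoint 0 : 𝕊 1) : 𝔼 2)
    rw [← ha, fibreRot_neg_one_circlePoint, sub_self]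
  · obtain ⟨G, hG, hθG, hdeg⟩ := hang δ
    have hval : ∀ t, fibreRot (-1) ((circlePoint a : 𝕊 1) : 𝔼 2) (θ (δ t) : 𝔼 2) =
        ((circlePoint (2 * π * G t - a) : 𝕊 1) : 𝔼 2) := fun t => by
      rw [hθG t, fibreRot_neg_one_circlePoint]
    -- at `t = 0` the value is `e₀`, so `2πG(0) - a ∈ 2πℤ`
    have h0 : circlePoint (2 * π * G 0 - a) = circlePoint 0 := by
      apply Subtype.ext
      rw [← hval 0, δ.source, ← ha, fibreRot_neg_one_circlePoint, sub_self]
    obtain ⟨m, hm⟩ := exists_eq_add_of_circlePoint_eq h0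
    refine ⟨fun t => G t - G 0, hG.sub continuous_const, sub_self _, ?_, fun t => ?_⟩
    · show G 1 - G 0 = _
      exact hdeg
    · show fibreRot (-1) ((circlePoint a : 𝕊 1) : 𝔼 2) (θ (δ t) : 𝔼 2) =
        ((circlePoint (2 * π * (G t - G 0)) : 𝕊 1) : 𝔼 2)
      rw [hval t, show 2 * π * G t - a = 2 * π * (G t - G 0) + m * (2 * π) by linarith,
        periodic_circlePoint.int_mul m]

end Winding

/-! ### The framing twisted by a circle-valued map -/

namespace FramedTubularEmbedding

variable {n : ℕ} {M : Type} [TopologicalSpace M] [ChartedSpace (𝔼 n) M]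
  (E : FramedTubularEmbedding n 2 M)

/-- The core embedding is injective. [folklore] -/
theorem injective_emb : Injective E.emb :=
  fun _ _ h => congrArg Prod.fst (E.injective_tube h)

/-- The field of fibre rotations `x ↦ rotEquiv (u x)` is smooth for smooth `u`. [folklore] -/
theorem contMDiff_rotEquiv_comp {u : M → 𝕊 1} (hu : ContMDiff (𝓡 n) (𝓡 1) ∞ u) :
    ContMDiff (𝓡 n) 𝓘(ℝ, 𝔼 2 →L[ℝ] 𝔼 2) ∞
      (fun x => ((rotEquiv (u x) : 𝔼 2 ≃L[ℝ] 𝔼 2) : 𝔼 2 →L[ℝ] 𝔼 2)) := by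
  haveI : Fact (Module.finrank ℝ (𝔼 2) = 1 + 1) := ⟨by simp⟩
  have heq : (fun x => ((rotEquiv (u x) : 𝔼 2 ≃L[ℝ] 𝔼 2) : 𝔼 2 →L[ℝ] 𝔼 2)) =
      fun x => rotCLM ((u x : 𝕊 1) : 𝔼 2) := funext fun x => rotEquiv_coe (u x)
  rw [heq]
  exact contDiff_rotCLM.comp_contMDiff (contMDiff_coe_sphere.comp hu)

/-! #### Twisted pushoffs and their classes (no smoothness needed) -/

section Pushoff

variable [CompactSpace M]

/-- **The pushoff of a loop of the core twisted by `u`** (`u x₀ = e₀`): `t ↦ tube (δ t, u (δ t))`,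
a loop at `p₀` in the complement of the core. [folklore] -/
def twistedPushoff {x₀ : M} (u : M → 𝕊 1) (hu : Continuous u) (hu0 : u x₀ = circlePoint 0)
    (δ : Path x₀ x₀) : Path (E.basePt' x₀) (E.basePt' x₀) where
  toFun t := ⟨E.tube (δ t, ((u (δ t) : 𝕊 1) : 𝔼 2)),
    E.tube_mem_embCompl _ (ne_zero_of_mem_unit_sphere _)⟩
  continuous_toFun := (E.continuous_tube.comp (δ.continuous.prodMk
    (continuous_subtype_val.comp (hu.comp δ.continuous)))).subtype_mk _
  source' := by
    apply Subtype.ext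
    show E.tube (δ 0, ((u (δ 0) : 𝕊 1) : 𝔼 2)) = E.basePt x₀
    rw [δ.source, hu0]
    rfl
  target' := by
    apply Subtype.ext
    show E.tube (δ 1, ((u (δ 1) : 𝕊 1) : 𝔼 2)) = E.basePt x₀
    rw [δ.target, hu0]
    rfl

/-- Values of the twisted pushoff. [folklore] -/
@[simp] theorem twistedPushoff_apply_coe {x₀ : M} (u : M → 𝕊 1) (hu : Continuous u)
    (hu0 : u x₀ = circlePoint 0) (δ : Path x₀ x₀) (t : unitInterval) :
    ((E.twistedPushoff u hu hu0 δ t : E.embCompl) : 𝕊 (n + 2)) =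
      E.tube (δ t, ((u (δ t) : 𝕊 1) : 𝔼 2)) := rfl

/-- The map `(x, b) ↦ tube (x, e^{2πib})` of `M × ℝ` into the complement. [folklore] -/
def tubeAngleMap : C(M × ℝ, E.embCompl) :=
  ⟨fun q => ⟨E.tube (q.1, ((circlePoint (2 * π * q.2) : 𝕊 1) : 𝔼 2)),
    E.tube_mem_embCompl _ (ne_zero_of_mem_unit_sphere _)⟩,
    (E.continuous_tube.comp (continuous_fst.prodMk (continuous_subtype_val.comp
      (continuous_circlePoint.comp (continuous_const.mul continuous_snd))))).subtype_mk _⟩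

/-- Values of `tubeAngleMap`. [folklore] -/
@[simp] theorem coe_tubeAngleMap_apply (q : M × ℝ) :
    (E.tubeAngleMap q : 𝕊 (n + 2)) =
      E.tube (q.1, ((circlePoint (2 * π * q.2) : 𝕊 1) : 𝔼 2)) := rfl

/-- **The twisted pushoff is the pushoff followed by the `k`-fold meridian**, `k` the winding
number of `u` along `δ`: if `u (δ t) = e^{2πiB(t)}` with `B` continuous, `B 0 = 0`, `B 1 = k`,
then `[t ↦ tube (δ t, u (δ t))] = [pushoff δ]·[μᵏ]` in `π₁(Sⁿ⁺² ∖ M, p₀)`.  Proof: the three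
loops are the images under `(x, b) ↦ tube (x, e^{2πib})` of the paths `(δ, B)`, `(δ, 0)`,
`(x₀, kt)` of `M × ℝ`; the first is homotopic to `(δ, kt)` (`ℝ` is simply connected), which is
`(δ·x₀, 0·(kt))` up to reparametrisation (`Path.trans_prod_eq_prod_trans`), the composite of the
last two. [cite: HatcherAT2002, Prop. 1.12] -/
theorem twistedPushoff_homotopic {x₀ : M} {u : M → 𝕊 1} (hu : Continuous u)
    (hu0 : u x₀ = circlePoint 0) (δ : Path x₀ x₀) {k : ℤ} {B : unitInterval → ℝ} (hBc : Continuous B)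
    (hB0 : B 0 = 0) (hB1 : B 1 = k)
    (hBu : ∀ t, ((u (δ t) : 𝕊 1) : 𝔼 2) = ((circlePoint (2 * π * B t) : 𝕊 1) : 𝔼 2)) :
    (E.twistedPushoff u hu hu0 δ).Homotopic ((E.pushoff δ).trans (E.meridianPow x₀ k)) := by
  -- the angle function as a path of `ℝ` from `0` to `k`
  obtain ⟨bB, hbB⟩ : ∃ bB : Path (0 : ℝ) (k : ℝ), ∀ t, bB t = B t :=
    ⟨{ toFun := B, continuous_toFun := hBc, source' := hB0, target' := hB1 }, fun _ => rfl⟩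
  -- the end points
  have e0 : E.basePt' x₀ = E.tubeAngleMap (x₀, 0) := by
    apply Subtype.ext
    show E.basePt x₀ = E.tube (x₀, ((circlePoint (2 * π * 0) : 𝕊 1) : 𝔼 2))
    rw [mul_zero]
    rfl
  have e1 : E.basePt' x₀ = E.tubeAngleMap (x₀, (k : ℝ)) := by
    apply Subtype.ext
    show E.tube (x₀, ((circlePoint 0 : 𝕊 1) : 𝔼 2)) =
      E.tube (x₀, ((circlePoint (2 * π * k) : 𝕊 1) : 𝔼 2))
    rw [← circlePoint_two_pi_mul_int k, mul_one]
  -- the three loops as images of paths of `M × ℝ`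
  have hL : E.twistedPushoff u hu hu0 δ =
      ((δ.prod bB).map E.tubeAngleMap.continuous).cast e0 e1 := by
    refine Path.ext (funext fun t => Subtype.ext ?_)
    show E.tube (δ t, ((u (δ t) : 𝕊 1) : 𝔼 2)) =
      E.tube (δ t, ((circlePoint (2 * π * bB t) : 𝕊 1) : 𝔼 2))
    rw [hbB t, hBu t]
  have hA : E.pushoff δ =
      ((δ.prod (Path.refl (0 : ℝ))).map E.tubeAngleMap.continuous).cast e0 e0 := by
    refine Path.ext (funext fun t => Subtype.ext ?_)
    show E.tube (δ t, ((circlePoint 0 : 𝕊 1) : 𝔼 2)) =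
      E.tube (δ t, ((circlePoint (2 * π * 0) : 𝕊 1) : 𝔼 2))
    rw [mul_zero]
  have hB' : E.meridianPow x₀ k =
      (((Path.refl x₀).prod (segK k)).map E.tubeAngleMap.continuous).cast e0 e1 := by
    refine Path.ext (funext fun t => Subtype.ext ?_)
    show E.tube (x₀, ((circlePoint (2 * π * k * t) : 𝕊 1) : 𝔼 2)) =
      E.tube (x₀, ((circlePoint (2 * π * ((k : ℝ) * t)) : 𝕊 1) : 𝔼 2))
    rw [mul_assoc]
  -- the homotopy in `M × ℝ`
  have h1 : (δ.prod bB).Homotopic (δ.prod (segK k)) :=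
    ⟨Path.Homotopic.prodHomotopy (Path.Homotopy.refl δ)
      (SimplyConnectedSpace.paths_homotopic bB (segK k)).some⟩
  have h2 : (δ.prod (segK k)).Homotopic
      ((δ.prod (Path.refl (0 : ℝ))).trans ((Path.refl x₀).prod (segK k))) := by
    rw [Path.trans_prod_eq_prod_trans]
    exact ⟨(Path.Homotopic.prodHomotopy (Path.Homotopy.transRefl δ)
      (Path.Homotopy.reflTrans (segK k))).symm⟩
  have hc := homotopic_cast ((h1.trans h2).map E.tubeAngleMap) e0 e1
  rw [hL, hA, hB', cast_map_trans]
  exact hc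

end Pushoff

/-! #### The twist by rotations -/

section Twist

variable [IsManifold (𝓡 n) ∞ M]

/-- **The framed tubular embedding twisted by the rotations of angle `u`**, `u : M → S¹` smooth:
`(x, w) ↦ E.tube (x, u(x)·w)` — the tree's `FramedTubularEmbedding.twist` by the field of fibre
rotations `rotEquiv ∘ u` (Kirby 1989, proof of VIII Thm. 3: changing the trivialisation of the
normal bundle of `N` by a map `N → SO(2)`). [cite: Kirby1989, Ch. VIII, proof of Thm. 3 (p. 45)] -/
def rotTwist (u : M → 𝕊 1) (hu : ContMDiff (𝓡 n) (𝓡 1) ∞ u) : FramedTubularEmbedding n 2 M :=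
  E.twist (fun x => rotEquiv (u x)) (contMDiff_rotEquiv_comp hu)

/-- The tube of the twisted framing: `(E.rotTwist u).tube (x, w) = E.tube (x, u(x)·w)`. [folklore] -/
@[simp] theorem rotTwist_tube_apply {u : M → 𝕊 1} (hu : ContMDiff (𝓡 n) (𝓡 1) ∞ u) (x : M)
    (w : 𝔼 2) :
    (E.rotTwist u hu).tube (x, w) = E.tube (x, fibreRot 1 ((u x : 𝕊 1) : 𝔼 2) w) := rfl

/-- **Twisting does not move the core**: `(E.rotTwist u).emb = E.emb`. [folklore] -/
@[simp] theorem rotTwist_emb {u : M → 𝕊 1} (hu : ContMDiff (𝓡 n) (𝓡 1) ∞ u) :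
    (E.rotTwist u hu).emb = E.emb :=
  E.twist_emb _

variable [CompactSpace M]

/-- The complement of the core is unchanged by the twist (as a subset of the sphere). [folklore] -/
theorem mem_rotTwist_embCompl_iff {u : M → 𝕊 1} (hu : ContMDiff (𝓡 n) (𝓡 1) ∞ u)
    {p : 𝕊 (n + 2)} : p ∈ (E.rotTwist u hu).embCompl ↔ p ∈ E.embCompl := by
  rw [mem_embCompl_iff, mem_embCompl_iff, rotTwist_emb]

/-- **The identity of the complements** of the core for the twisted and the original framing, as a
continuous map. [folklore] -/
def rotTwistIncl (u : M → 𝕊 1) (hu : ContMDiff (𝓡 n) (𝓡 1) ∞ u) :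
    C((E.rotTwist u hu).embCompl, E.embCompl) :=
  ⟨fun z => ⟨z.1, (E.mem_rotTwist_embCompl_iff hu).1 z.2⟩, continuous_subtype_val.subtype_mk _⟩

/-- Values of `rotTwistIncl` (the identity on points of the sphere). [folklore] -/
@[simp] theorem coe_rotTwistIncl {u : M → 𝕊 1} (hu : ContMDiff (𝓡 n) (𝓡 1) ∞ u)
    (z : (E.rotTwist u hu).embCompl) : (E.rotTwistIncl u hu z : 𝕊 (n + 2)) = z.1 := rfl

/-- When `u x₀ = e₀` the twist fixes the base point `p₀ = tube (x₀, e₀)`. [folklore] -/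
theorem rotTwistIncl_basePt' {u : M → 𝕊 1} (hu : ContMDiff (𝓡 n) (𝓡 1) ∞ u) {x₀ : M}
    (hu0 : u x₀ = circlePoint 0) :
    E.rotTwistIncl u hu ((E.rotTwist u hu).basePt' x₀) = E.basePt' x₀ := by
  apply Subtype.ext
  show (E.rotTwist u hu).tube (x₀, ((circlePoint 0 : 𝕊 1) : 𝔼 2)) =
    E.tube (x₀, ((circlePoint 0 : 𝕊 1) : 𝔼 2))
  rw [rotTwist_tube_apply, hu0, fibreRot_circlePoint_zero]

/-- **Transport of a homomorphism on `π₁` of the complement to the twisted framing**: for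
`φ : π₁(Sⁿ⁺² ∖ M, p₀) → G` and a twisted framing with `u x₀ = e₀`, the composite
`φ' = φ ∘ (identity)_*` evaluates on the class of a loop `γ'` of the twisted complement as `φ` on
any loop `γ` of the original complement with the same values in the sphere. [folklore] -/
theorem comp_mapOfEq_rotTwistIncl_apply {G : Type*} [Group G] {u : M → 𝕊 1}
    (hu : ContMDiff (𝓡 n) (𝓡 1) ∞ u) {x₀ : M} (hu0 : u x₀ = circlePoint 0)
    (φ : FundamentalGroup E.embCompl (E.basePt' x₀) →* G)
    (γ' : Path ((E.rotTwist u hu).basePt' x₀) ((E.rotTwist u hu).basePt' x₀))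
    (γ : Path (E.basePt' x₀) (E.basePt' x₀))
    (h : ∀ t, ((γ' t : (E.rotTwist u hu).embCompl) : 𝕊 (n + 2)) = (γ t : E.embCompl)) :
    (φ.comp (FundamentalGroup.mapOfEq (E.rotTwistIncl u hu) (E.rotTwistIncl_basePt' hu hu0)))
        (FundamentalGroup.fromPath ⟦γ'⟧ₚ) = φ (FundamentalGroup.fromPath ⟦γ⟧ₚ) := by
  rw [MonoidHom.comp_apply, FundamentalGroup.mapOfEq_apply]
  have hγ : (γ'.map (E.rotTwistIncl u hu).continuous).cast (E.rotTwistIncl_basePt' hu hu0).symm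
      (E.rotTwistIncl_basePt' hu hu0).symm = γ :=
    Path.ext (funext fun t => Subtype.ext (h t))
  congr 1
  show (⟦γ'.map (E.rotTwistIncl u hu).continuous⟧ₚ).cast _ _ = ⟦γ⟧ₚ
  rw [← Path.Homotopic.Quotient.mk_cast, hγ]

/-- **Re-framing so that a linking homomorphism kills the pushoffs** (Kirby 1989, proof of VIII
Thm. 3, for `Q = Sⁿ⁺²` and a connected core `M`, `n ≥ 1`): there is a smooth `u : M → S¹` and a
homomorphism `φ' : π₁(Sⁿ⁺² ∖ M, p₀) → ℤ` for the complement of the **twisted** framing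
`E.rotTwist u` with `φ' [μ] = 1` and `φ' [pushoff δ] = 0` for every loop `δ` of the core at `x₀`.
Proof: the linking homomorphism `φ` (`exists_linkingHom_of_connectedSpace`: `φ [μᵏ] = k`), the
circle-valued `u` realising `δ ↦ -φ [pushoff δ]` with `u x₀ = e₀`
(`exists_circleMap_winding_eq`), and `twistedPushoff_homotopic`: the pushoff of `δ` for the
twisted framing is the `u`-twisted pushoff of `E`, of class `[pushoff δ]·[μ]^{-φ [pushoff δ]}`.
[cite: Kirby1989, Ch. VIII, proof of Thm. 3 (p. 45)] -/
theorem exists_rotTwist_linkingHom_pushoff [ConnectedSpace M] (hn : 1 ≤ n) (x₀ : M) :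
    ∃ (u : M → 𝕊 1) (hu : ContMDiff (𝓡 n) (𝓡 1) ∞ u),
      ∃ φ' : FundamentalGroup (E.rotTwist u hu).embCompl ((E.rotTwist u hu).basePt' x₀) →*
          Multiplicative ℤ,
        φ' (FundamentalGroup.fromPath ⟦(E.rotTwist u hu).meridian x₀⟧ₚ) =
            Multiplicative.ofAdd 1 ∧
          ∀ δ : Path x₀ x₀, φ' (FundamentalGroup.fromPath ⟦(E.rotTwist u hu).pushoff δ⟧ₚ) = 1 := by
  haveI : Nonempty M := ⟨x₀⟩
  haveI : T2Space M := T2Space.of_injective_continuous E.injective_emb E.continuous_emb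
  obtain ⟨φ, hφ1, hφk⟩ := E.exists_linkingHom_of_connectedSpace hn x₀
  -- the homomorphism `δ ↦ φ [pushoff δ]⁻¹` on `π₁(M, x₀)`
  obtain ⟨ρ, hρ⟩ : ∃ ρ : FundamentalGroup M x₀ →* Multiplicative ℤ, ∀ δ : Path x₀ x₀,
      ρ (FundamentalGroup.fromPath ⟦δ⟧ₚ) = (φ (FundamentalGroup.fromPath ⟦E.pushoff δ⟧ₚ))⁻¹ :=
    ⟨(φ.comp (FundamentalGroup.map E.pushoffMap x₀))⁻¹, fun _ => rfl⟩
  obtain ⟨u, hu, hu0, hwind⟩ := exists_circleMap_winding_eq (n := n) x₀ ρ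
  refine ⟨u, hu, φ.comp (FundamentalGroup.mapOfEq (E.rotTwistIncl u hu)
    (E.rotTwistIncl_basePt' hu hu0)), ?_, fun δ => ?_⟩
  · -- the meridian of the twisted framing is the meridian
    have h : ∀ t, (((E.rotTwist u hu).meridian x₀ t : (E.rotTwist u hu).embCompl) : 𝕊 (n + 2)) =
        (E.meridian x₀ t : E.embCompl) := fun t => by
      rw [meridian_apply_coe, meridian_apply_coe, rotTwist_tube_apply, hu0,
        fibreRot_circlePoint_zero]
    rw [E.comp_mapOfEq_rotTwistIncl_apply hu hu0 φ ((E.rotTwist u hu).meridian x₀)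
      (E.meridian x₀) h]
    exact hφ1
  · -- the pushoff of the twisted framing is the twisted pushoff
    obtain ⟨B, hBc, hB0, hB1, hBu⟩ := hwind δ
    have h : ∀ t, (((E.rotTwist u hu).pushoff δ t : (E.rotTwist u hu).embCompl) : 𝕊 (n + 2)) =
        (E.twistedPushoff u hu.continuous hu0 δ t : E.embCompl) := fun t => by
      show (E.rotTwist u hu).tube (δ t, ((circlePoint 0 : 𝕊 1) : 𝔼 2)) =
        E.tube (δ t, ((u (δ t) : 𝕊 1) : 𝔼 2))
      rw [rotTwist_tube_apply, fibreRot_one_base]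
    rw [E.comp_mapOfEq_rotTwistIncl_apply hu hu0 φ ((E.rotTwist u hu).pushoff δ)
      (E.twistedPushoff u hu.continuous hu0 δ) h,
      Path.Homotopic.Quotient.eq.2 (E.twistedPushoff_homotopic hu.continuous hu0 δ hBc hB0 hB1 hBu),
      fromPath_mk_trans, map_mul, hφk, hρ, ofAdd_toAdd, inv_mul_cancel]

/-- **Seifert hypersurface data exist after re-framing** (connected compact core, `n ≥ 1`): for
the twisted framing of `exists_rotTwist_linkingHom_pushoff` the circle-valued map of the
complement equal to the fibre angle near the core, with a regular value whose antipode is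
regular, exists (`nonempty_seifertHypersurfaceDatum_of_linkingHom`).
[cite: Kirby1989, Ch. VIII, proof of Thm. 3 (p. 45)] -/
theorem exists_rotTwist_nonempty_seifertHypersurfaceDatum [ConnectedSpace M] [Nonempty M]
    (hn : 1 ≤ n) :
    ∃ (u : M → 𝕊 1) (hu : ContMDiff (𝓡 n) (𝓡 1) ∞ u),
      Nonempty (SeifertHypersurfaceDatum (E.rotTwist u hu)) := by
  obtain ⟨u, hu, φ', h1, h2⟩ := E.exists_rotTwist_linkingHom_pushoff hn (Classical.arbitrary M)
  exact ⟨u, hu, (E.rotTwist u hu).nonempty_seifertHypersurfaceDatum_of_linkingHom _ φ' h1 h2⟩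

end Twist

end FramedTubularEmbedding

end Literature.Topology.FourManifolds
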